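import Mathlib
import HarnessLib
import Summits.CriticalPhenomena.PercolationContinuityZ3.Theses.PercTreeValue
import Literature.Probability.Percolation.BlockResampling
import Literature.Probability.Percolation.InfiniteClusterDensity
import Literature.Probability.Percolation.TwoPointFunction
import Literature.Probability.Percolation.CriticalContinuityProofs
import Literature.Probability.Percolation.BondPercolationSymmetry
import Summits.CriticalPhenomena.PercolationContinuityZ3.Theorems.PercTreeValueTetrahedronHarrisGapStubCondHarris
import Summits.CriticalPhenomena.PercolationContinuityZ3.Theorems.PercTreeValueTetrahedronHarrisGapStubCap
import Summits.CriticalPhenomena.PercolationContinuityZ3.Theorems.PercTreeValueTetrahedronHarrisGapStubCovSlicing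
import Summits.CriticalPhenomena.PercolationContinuityZ3.Theorems.PercTreeValueTetrahedronHarrisGapStubG
import Summits.CriticalPhenomena.PercolationContinuityZ3.Theorems.PercTreeValueTetrahedronHarrisGapStubBlock
import Summits.CriticalPhenomena.PercolationContinuityZ3.Theorems.PercTreeValueTetrahedronHarrisGapReduction
import Summits.CriticalPhenomena.PercolationContinuityZ3.Theorems.PercTreeValueTetrahedronHarrisGapCoherenceReduction
import Summits.CriticalPhenomena.PercolationContinuityZ3.Theorems.PercTreeValueTetrahedronHarrisGapStubMirror
import Summits.CriticalPhenomena.PercolationContinuityZ3.Theorems.PercTreeValueTetrahedronHarrisGapStubCoherenceOfInputs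
import Summits.CriticalPhenomena.PercolationContinuityZ3.Theorems.PercTreeValueTetrahedronHarrisGapSandwich
import Summits.CriticalPhenomena.PercolationContinuityZ3.Theorems.PercTreeValueTetrahedronDisjointCoexistenceStubTiledShell
import Summits.CriticalPhenomena.PercolationContinuityZ3.Theorems.PercTreeValueTetrahedronDisjointCoexistenceStubShellDecoupling
import Summits.CriticalPhenomena.PercolationContinuityZ3.Theorems.PercTreeValueTetrahedronDisjointCoexistenceStubMirrorRestrict
import Summits.CriticalPhenomena.PercolationContinuityZ3.Theorems.PercTreeValueTetrahedronDisjointCoexistenceStubPairSymm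
import Summits.CriticalPhenomena.PercolationContinuityZ3.Theorems.PercTreeValueTetrahedronDisjointCoexistenceStubRestrictProduct
import Summits.CriticalPhenomena.PercolationContinuityZ3.Theorems.PercTreeValueTetrahedronDisjointCoexistenceStubConfineProduct
import Literature.Probability.Percolation.SharpnessDCTProofs
import Literature.Probability.Percolation.PercolationProofs
import Summits.CriticalPhenomena.PercolationContinuityZ3.Theorems.PercTreeValueTetrahedronHarrisGapStubOffCollarIdentity
import Summits.CriticalPhenomena.PercolationContinuityZ3.Theorems.PercTreeValueTetrahedronHarrisGapStubDeterminedByBlockCondProb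
import Summits.CriticalPhenomena.PercolationContinuityZ3.Theorems.PercTreeValueTetrahedronHarrisGapStubSetIntegralBlockCondProb
import Summits.CriticalPhenomena.PercolationContinuityZ3.Theorems.PercTreeValueTetrahedronHarrisGapStubCollarShellProbability
import Summits.CriticalPhenomena.PercolationContinuityZ3.Theorems.PercTreeValueTetrahedronHarrisGapStubCrossedPairSymmetry
import Summits.CriticalPhenomena.PercolationContinuityZ3.Theorems.PercTreeValueTetrahedronHarrisGapCollarReduction
import Summits.CriticalPhenomena.PercolationContinuityZ3.Theorems.PercTreeValueTetrahedronHarrisGapRestrictedGluingWorld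

/-!
# Line `SketchIdeator1` (total covariance w.r.t. a finite block) — skeleton rev 7 for crux
`TetrahedronHarrisGap` (stmt-CriticalPhenomena-7799), route `PercTreeValue`

Lead: prover-line-stmt-CriticalPhenomena-7799-c3-0 (continuation c3), rev 7 (2026-08-17; rev 7.2: composition `stub_cruxOfCollar` and all five
helper stubs LANDED — p148114 p149690 p150601 p151166 p151031 p152050): RESHAPE — a SECOND composition
`TetrahedronHarrisGap_of_collar` (section "Rev 7" at the end of this file) keeps the HARVESTED term of the card's total-covariance
identity on the closed-collar block of the sibling crux stmt-7798 and reduces the crux to X_B (stmt-0846) ∧ BoxRestriction (7798's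
registered open stub S5', verbatim) ∧ RestrictedGluing (new, world-neutral); rev 6 (lead c2 = rev 5.2 of lead c1: crux ⇐
`stub_annulusNonCrossing` ∧ `stub_coherence`) is kept verbatim below as the first composition `TetrahedronHarrisGap_of`.

Crux (by name, `Summit.CriticalPhenomena.PercolationContinuityZ3.Theses.PercTreeValue.TetrahedronHarrisGap`):
`∃ δ > 0, ∃ r₀, ∀ r ≥ r₀, (1+δ) τ(0,a_r) τ(b_r,c_r) ≤ P_{p_c}(0 ↔ a_r ∧ b_r ↔ c_r)` on `ℤ³`,
`a_r = (r,r,0)`, `b_r = (r,0,r)`, `c_r = (0,r,r)`.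

## What changed in rev 5 (RESHAPE — a strict weakening of the open content)

Revs 1–4 (lead …-7799-0) reduced the crux to THREE open inputs `stub_G` (gluing-lite / pointwise
hyperscaling-lite), `stub_block` (⇐ `PercAnnulusCrossing.CritAnnulusNonCrossing`, stmt-0846) and `stub_fatGap`
(relative Harris gap for all two-sided-fat level sets of the two bulk hook probabilities), via layer-cake slicing.

Rev 5 observes that the slicing detour is unnecessary and that TWO of the three open inputs can be merged into one
WEAKER statement.  Write `P = P_{p_c}`, `K_r` = the lattice edges touching the four corner boxes of sup-radius `r/8`,
`f_r = P(0 ↔ a_r | ω off K_r)`, `g_r = P(b_r ↔ c_r | ω off K_r)` (`blockCondProb`, BlockResampling.lean).  Then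

1. `Cov(1_A, 1_B) ≥ Cov(f_r, g_r)` (conditional Harris in the block + tower property; LANDED, `stub_condHarris`,
   `integral_blockCondProb_eq`);
2. `Var f_r ≥ P(f_r = 0) · τ(0,a_r)² ≥ c_B τ(0,a_r)²` — the "influence variance" lower bound of ideator 2's card
   `mirror-window-influence` (its crux K1) is, for THIS window (complement of the corner boxes), a ONE-LINE COROLLARY of
   blocking: on `{f_r = 0}` the deviation `(f_r − E f_r)²` equals `τ²`.  So K1 ⇐ `stub_block` ⇐ stmt-0846 (landed
   conditional form `stub_block_of_critAnnulusNonCrossing`, p104006);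
3. the ONLY remaining transfer statement is COHERENCE: `Cov(f_r, g_r) ≥ c · Var f_r` uniformly in `r`
   (`stub_coherence`; = ideator 2's `MirrorCoherence` transplanted from the slab window to the corner-ball bulk,
   where K1 is free).  Since `g_r = f_r ∘ σ̂_r` for the lattice involution `σ_r : x ↦ (r − x₀, x₁, r − x₂)`
   (`stub_mirror`, provable) and `P` is `σ̂_r`-invariant, `Cov(f,g) = Var f_sym − Var f_anti` and
   `Var f = Var f_sym + Var f_anti` (`f_sym/anti = (f ± f∘σ̂)/2`), so coherence says: the mirror-odd part of the
   bulk's influence on the hook probability does not carry all of its variance, `‖f_anti‖₂² ≤ (1−c)/(1+c) ‖f_sym−τ‖₂²`.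
4. Composition: `P(A ∩ B) ≥ ∫ f g ≥ τ_A τ_B + c Var f ≥ τ_A τ_B + c c_B τ_A² = (1 + c c_B) τ_A τ_B`
   (`τ_B = τ_A`, `tau_opposite_edge_eq`, LANDED p103390).  `crux_of_block_of_coherence` below, sorry-free.

MONOTONICITY OF THE RESHAPE: the rev-4 open inputs imply the rev-5 one — `stub_G ∧ stub_block ∧ stub_fatGap ⇒
stub_coherence` with `c = δ' c₀⁴ / 256` (the rev-4 composition gives `Cov(f,g) ≥ δ'(c₀²π_r²/16)²` and the cap gives
`Var f ≤ ∫ f² ≤ π_r² τ ≤ π_r⁴`); registered as `stub_coherence_of_cornerBallInputs` (provable from landed files,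
delegated).  Conversely coherence does NOT imply G or fatGap.  So rev 5 asks strictly less of ℤ³ than rev 4, and
`stub_G` (hyperscaling-lite) has left the critical path of this line altogether.

## Registered stubs of rev 5

* `stub_annulusNonCrossing` — OPEN = the EXISTING crux item stmt-CriticalPhenomena-0846 (by name).
* `stub_block` — CLOSED modulo `stub_annulusNonCrossing` (p104006).
* `stub_coherence` — OPEN, the line's single transfer statement (hardest stub; lead).
* `stub_mirror` — LANDED p121448 (lattice involution exchanging the two pairings).
* `stub_coherence_of_cornerBallInputs` — LANDED p121670 (monotonicity of the reshape).
* `crux_of_block_of_coherence` — the composition, LANDED p121115 (`Theorems/PercTreeValueTetrahedronHarrisGapCoherenceReduction.lean`).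
* `TetrahedronHarrisGap_of` concludes the crux BY NAME; direct `sorry` only inside `stub_*`.

Barrier bookkeeping: blocking fails in every jump world and above six dimensions (crossing probabilities → 1), as
`SpanningClustersAboveSix` / `LongRangeDiscontinuity` demand — it carries the CONTINUITY content of the composition.  Coherence is
false on the subdivided star tree (disjoint supports: `Cov = 0 < Var`); in a jump world and in mean field both `Var f_r` and
`Cov(f_r,g_r)` are `o(τ²)` and their ratio is NOT settled by soft arguments (heuristically corr → 0 by decorrelation of the four
corner neighbourhoods) — so coherence is the structural ℤ³ input standing next to an existing summit-sufficient item, the split one wants.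
Also landed: `crux_of_varLower_of_coherence` / `varLower_of_block` (`…VarianceReduction.lean`, p122656): the composition cut at the
influence-variance joint (`Var f_r ≥ c_V τ²` ∧ coherence ⟹ crux), so any other proof of K1 can replace blocking;
`integral_blockCondProb_mul_antitone` (`…HarvestMonotone.lean`, p122318): monotonicity of `∫ f_W g_W` in the window;
`coherenceAt_iff_antiVar_le` (`…CoherenceIff.lean`, p122475): the isotropy form of coherence.  Window hierarchy: crux dossier §R5.5.
Disproof.lean: none exists for this crux (2026-08-16, `ledger crux ls`).
-/

noncomputable section

open MeasureTheory Filter Set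
open Literature.Probability.Percolation Literature.Probability.LatticeModels

namespace Summit.CriticalPhenomena.PercolationContinuityZ3.Cruxes.TetrahedronHarrisGap.CornerBallTotalCovariance

/-! ## Registered stubs (DEF-FREE over tree declarations) -/

/-- **stub_annulusNonCrossing** (OPEN = the EXISTING crux item stmt-CriticalPhenomena-0846 of route
`PercAnnulusCrossing`, imported BY NAME): at `p_c(ℤ³)`, uniformly in `n ≥ 1`, with probability `≥ c` there is no open
path inside `B(2n)` from `B(n)` to the inner vertex boundary of `B(2n)`. -/
theorem stub_annulusNonCrossing :
    Summit.CriticalPhenomena.PercolationContinuityZ3.Theses.PercAnnulusCrossing.CritAnnulusNonCrossing := by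
  sorry

/-- **stub_block — CLOSED modulo `stub_annulusNonCrossing`** (conditional form LANDED p104006,
`Summit.CriticalPhenomena.PercolationContinuityZ3.Theorems.TetrahedronHarrisGap.stub_block_of_critAnnulusNonCrossing`):
with probability at least `c_B` the bulk admits no hook at all from `0` to `a_r` (resp. from `b_r` to `c_r`). -/
theorem stub_block :
    ∃ c_B : ℝ, 0 < c_B ∧ ∃ r₀ : ℕ, ∀ r : ℕ, r₀ ≤ r →
      c_B ≤ (bondPercolation (zdGraph 3) (criticalProbI 3)).real
          {ω | blockCondProb (zdGraph 3) (criticalProbI 3)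
              (armEdges (r / 8) (0 : Site 3) ∪ armEdges (r / 8) ![(r : ℤ), (r : ℤ), 0] ∪
                armEdges (r / 8) ![(r : ℤ), 0, (r : ℤ)] ∪ armEdges (r / 8) ![0, (r : ℤ), (r : ℤ)])
              (openConn (0 : Site 3) ![(r : ℤ), (r : ℤ), 0]) ω = 0} ∧
      c_B ≤ (bondPercolation (zdGraph 3) (criticalProbI 3)).real
          {ω | blockCondProb (zdGraph 3) (criticalProbI 3)
              (armEdges (r / 8) (0 : Site 3) ∪ armEdges (r / 8) ![(r : ℤ), (r : ℤ), 0] ∪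
                armEdges (r / 8) ![(r : ℤ), 0, (r : ℤ)] ∪ armEdges (r / 8) ![0, (r : ℤ), (r : ℤ)])
              (openConn ![(r : ℤ), 0, (r : ℤ)] ![0, (r : ℤ), (r : ℤ)]) ω = 0} :=
  Summit.CriticalPhenomena.PercolationContinuityZ3.Theorems.TetrahedronHarrisGap.stub_block_of_critAnnulusNonCrossing
    stub_annulusNonCrossing

/-- **stub_coherence** (OPEN — the line's single transfer statement in rev 5; "mirror coherence of the bulk
influence"). Uniformly in `r`, the covariance of the two bulk hook probabilities `f_r = P(0↔a_r | ω off K_r)`,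
`g_r = P(b_r↔c_r | ω off K_r)` is at least a constant times the variance of one of them:
`c · Var f_r ≤ Cov(f_r, g_r)`.  (`g_r = f_r ∘ σ̂_r` by `stub_mirror`, so this is `corr(f_r, f_r ∘ σ̂_r) ≥ c`.)
Fails in every jump world and above six dimensions; numerically `Cov(f,g) ≈ 0.25 τ²` at `r = 16` (kit j017749). -/
theorem stub_coherence :
    ∃ c : ℝ, 0 < c ∧ ∃ r₀ : ℕ, ∀ r : ℕ, r₀ ≤ r →
      c * (∫ ω, blockCondProb (zdGraph 3) (criticalProbI 3)
              (armEdges (r / 8) (0 : Site 3) ∪ armEdges (r / 8) ![(r : ℤ), (r : ℤ), 0] ∪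
                armEdges (r / 8) ![(r : ℤ), 0, (r : ℤ)] ∪ armEdges (r / 8) ![0, (r : ℤ), (r : ℤ)])
              (openConn (0 : Site 3) ![(r : ℤ), (r : ℤ), 0]) ω ^ 2 ∂(bondPercolation (zdGraph 3) (criticalProbI 3)) -
            (∫ ω, blockCondProb (zdGraph 3) (criticalProbI 3)
              (armEdges (r / 8) (0 : Site 3) ∪ armEdges (r / 8) ![(r : ℤ), (r : ℤ), 0] ∪
                armEdges (r / 8) ![(r : ℤ), 0, (r : ℤ)] ∪ armEdges (r / 8) ![0, (r : ℤ), (r : ℤ)])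
              (openConn (0 : Site 3) ![(r : ℤ), (r : ℤ), 0]) ω ∂(bondPercolation (zdGraph 3) (criticalProbI 3))) ^ 2) ≤
        ∫ ω, blockCondProb (zdGraph 3) (criticalProbI 3)
              (armEdges (r / 8) (0 : Site 3) ∪ armEdges (r / 8) ![(r : ℤ), (r : ℤ), 0] ∪
                armEdges (r / 8) ![(r : ℤ), 0, (r : ℤ)] ∪ armEdges (r / 8) ![0, (r : ℤ), (r : ℤ)])
              (openConn (0 : Site 3) ![(r : ℤ), (r : ℤ), 0]) ω *
            blockCondProb (zdGraph 3) (criticalProbI 3)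
              (armEdges (r / 8) (0 : Site 3) ∪ armEdges (r / 8) ![(r : ℤ), (r : ℤ), 0] ∪
                armEdges (r / 8) ![(r : ℤ), 0, (r : ℤ)] ∪ armEdges (r / 8) ![0, (r : ℤ), (r : ℤ)])
              (openConn ![(r : ℤ), 0, (r : ℤ)] ![0, (r : ℤ), (r : ℤ)]) ω ∂(bondPercolation (zdGraph 3) (criticalProbI 3)) -
          (∫ ω, blockCondProb (zdGraph 3) (criticalProbI 3)
              (armEdges (r / 8) (0 : Site 3) ∪ armEdges (r / 8) ![(r : ℤ), (r : ℤ), 0] ∪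
                armEdges (r / 8) ![(r : ℤ), 0, (r : ℤ)] ∪ armEdges (r / 8) ![0, (r : ℤ), (r : ℤ)])
              (openConn (0 : Site 3) ![(r : ℤ), (r : ℤ), 0]) ω ∂(bondPercolation (zdGraph 3) (criticalProbI 3))) *
          (∫ ω, blockCondProb (zdGraph 3) (criticalProbI 3)
              (armEdges (r / 8) (0 : Site 3) ∪ armEdges (r / 8) ![(r : ℤ), (r : ℤ), 0] ∪
                armEdges (r / 8) ![(r : ℤ), 0, (r : ℤ)] ∪ armEdges (r / 8) ![0, (r : ℤ), (r : ℤ)])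
              (openConn ![(r : ℤ), 0, (r : ℤ)] ![0, (r : ℤ), (r : ℤ)]) ω ∂(bondPercolation (zdGraph 3) (criticalProbI 3))) := by
  sorry

/-- **stub_mirror — LANDED** (p121448, `Theorems/PercTreeValueTetrahedronHarrisGapStubMirror.lean`,
`Summit.CriticalPhenomena.PercolationContinuityZ3.Theorems.TetrahedronHarrisGap.stub_mirror`). The lattice involution `σ_r : x ↦ (r − x₀, x₁, r − x₂)` is a graph
automorphism of `ℤ³` exchanging `0 ↔ b_r` and `a_r ↔ c_r`; it maps the corner block `K_r` to itself, and relabelling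
configurations along it exchanges the two bulk hook probabilities: `g_r = f_r ∘ σ̂_r` and `f_r = g_r ∘ σ̂_r`
(`σ̂_r = BondConfig.relabel (sym2Equiv σ_r)`, under which `P_p` is invariant, `bondPercolation_map_relabel_iso`). -/
theorem stub_mirror :
    ∀ r : ℕ, ∃ φ : zdGraph 3 ≃g zdGraph 3,
      φ 0 = ![(r : ℤ), 0, (r : ℤ)] ∧ φ ![(r : ℤ), (r : ℤ), 0] = ![0, (r : ℤ), (r : ℤ)] ∧
      φ ![(r : ℤ), 0, (r : ℤ)] = 0 ∧ φ ![0, (r : ℤ), (r : ℤ)] = ![(r : ℤ), (r : ℤ), 0] ∧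
      (∀ ω : BondConfig (Site 3),
        blockCondProb (zdGraph 3) (criticalProbI 3)
            (armEdges (r / 8) (0 : Site 3) ∪ armEdges (r / 8) ![(r : ℤ), (r : ℤ), 0] ∪
              armEdges (r / 8) ![(r : ℤ), 0, (r : ℤ)] ∪ armEdges (r / 8) ![0, (r : ℤ), (r : ℤ)])
            (openConn ![(r : ℤ), 0, (r : ℤ)] ![0, (r : ℤ), (r : ℤ)]) ω =
          blockCondProb (zdGraph 3) (criticalProbI 3)
            (armEdges (r / 8) (0 : Site 3) ∪ armEdges (r / 8) ![(r : ℤ), (r : ℤ), 0] ∪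
              armEdges (r / 8) ![(r : ℤ), 0, (r : ℤ)] ∪ armEdges (r / 8) ![0, (r : ℤ), (r : ℤ)])
            (openConn (0 : Site 3) ![(r : ℤ), (r : ℤ), 0]) (BondConfig.relabel (sym2Equiv φ.toEquiv) ω)) ∧
      (∀ ω : BondConfig (Site 3),
        blockCondProb (zdGraph 3) (criticalProbI 3)
            (armEdges (r / 8) (0 : Site 3) ∪ armEdges (r / 8) ![(r : ℤ), (r : ℤ), 0] ∪
              armEdges (r / 8) ![(r : ℤ), 0, (r : ℤ)] ∪ armEdges (r / 8) ![0, (r : ℤ), (r : ℤ)])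
            (openConn (0 : Site 3) ![(r : ℤ), (r : ℤ), 0]) ω =
          blockCondProb (zdGraph 3) (criticalProbI 3)
            (armEdges (r / 8) (0 : Site 3) ∪ armEdges (r / 8) ![(r : ℤ), (r : ℤ), 0] ∪
              armEdges (r / 8) ![(r : ℤ), 0, (r : ℤ)] ∪ armEdges (r / 8) ![0, (r : ℤ), (r : ℤ)])
            (openConn ![(r : ℤ), 0, (r : ℤ)] ![0, (r : ℤ), (r : ℤ)]) (BondConfig.relabel (sym2Equiv φ.toEquiv) ω)) :=
  Summit.CriticalPhenomena.PercolationContinuityZ3.Theorems.TetrahedronHarrisGap.stub_mirror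

/-- **stub_coherence_of_cornerBallInputs — LANDED** (p121670,
`Theorems/PercTreeValueTetrahedronHarrisGapStubCoherenceOfInputs.lean`; MONOTONICITY OF THE RESHAPE). The three open inputs
of revs 1–4 — gluing-lite `stub_G` (one pair), blocking `stub_block`, and the relative level-set gap `stub_fatGap` —
imply `stub_coherence` (with `c = δ' c₀⁴ / 256`): the rev-4 composition bounds `Cov(f_r, g_r) ≥ δ'(c₀² π_r²/16)²`
(`stub_covSlicing` on the window `[c₀π_r²/8, c₀π_r²/4]`, LANDED), while the hook cap `f_r ≤ π_r²` (`stub_cap`, LANDED)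
gives `Var f_r ≤ ∫ f_r² ≤ π_r⁴`.  So rev 5 asks strictly less of `ℤ³` than rev 4. -/
theorem stub_coherence_of_cornerBallInputs :
    (∃ c₀ : ℝ, 0 < c₀ ∧ ∃ r₀ : ℕ, ∀ r : ℕ, r₀ ≤ r →
      c₀ * (bondPercolation (zdGraph 3) (criticalProbI 3)).real (boxArm (r / 8 + 1) (0 : Site 3)) ^ 2 ≤
        tau 3 (criticalProbI 3) 0 ![(r : ℤ), (r : ℤ), 0]) →
    (∃ c_B : ℝ, 0 < c_B ∧ ∃ r₀ : ℕ, ∀ r : ℕ, r₀ ≤ r →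
      let K : Finset (Sym2 (Site 3)) :=
        armEdges (r / 8) (0 : Site 3) ∪ armEdges (r / 8) ![(r : ℤ), (r : ℤ), 0] ∪
          armEdges (r / 8) ![(r : ℤ), 0, (r : ℤ)] ∪ armEdges (r / 8) ![0, (r : ℤ), (r : ℤ)];
      let f : BondConfig (Site 3) → ℝ :=
        blockCondProb (zdGraph 3) (criticalProbI 3) K (openConn (0 : Site 3) ![(r : ℤ), (r : ℤ), 0]);
      let g : BondConfig (Site 3) → ℝ :=
        blockCondProb (zdGraph 3) (criticalProbI 3) K (openConn ![(r : ℤ), 0, (r : ℤ)] ![0, (r : ℤ), (r : ℤ)]);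
      c_B ≤ (bondPercolation (zdGraph 3) (criticalProbI 3)).real {ω | f ω = 0} ∧
        c_B ≤ (bondPercolation (zdGraph 3) (criticalProbI 3)).real {ω | g ω = 0}) →
    (∀ κ : ℝ, 0 < κ → ∃ δ' : ℝ, 0 < δ' ∧ ∃ r₀ : ℕ, ∀ r : ℕ, r₀ ≤ r →
      let K : Finset (Sym2 (Site 3)) :=
        armEdges (r / 8) (0 : Site 3) ∪ armEdges (r / 8) ![(r : ℤ), (r : ℤ), 0] ∪
          armEdges (r / 8) ![(r : ℤ), 0, (r : ℤ)] ∪ armEdges (r / 8) ![0, (r : ℤ), (r : ℤ)];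
      let f : BondConfig (Site 3) → ℝ :=
        blockCondProb (zdGraph 3) (criticalProbI 3) K (openConn (0 : Site 3) ![(r : ℤ), (r : ℤ), 0]);
      let g : BondConfig (Site 3) → ℝ :=
        blockCondProb (zdGraph 3) (criticalProbI 3) K (openConn ![(r : ℤ), 0, (r : ℤ)] ![0, (r : ℤ), (r : ℤ)]);
      ∀ s t : ℝ,
      κ ≤ (bondPercolation (zdGraph 3) (criticalProbI 3)).real {ω | s < f ω} →
      (bondPercolation (zdGraph 3) (criticalProbI 3)).real {ω | s < f ω} ≤ 1 - κ →
      κ ≤ (bondPercolation (zdGraph 3) (criticalProbI 3)).real {ω | t < g ω} →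
      (bondPercolation (zdGraph 3) (criticalProbI 3)).real {ω | t < g ω} ≤ 1 - κ →
      δ' * ((bondPercolation (zdGraph 3) (criticalProbI 3)).real {ω | s < f ω} *
          (bondPercolation (zdGraph 3) (criticalProbI 3)).real {ω | t < g ω}) ≤
        (bondPercolation (zdGraph 3) (criticalProbI 3)).real ({ω | s < f ω} ∩ {ω | t < g ω}) -
          (bondPercolation (zdGraph 3) (criticalProbI 3)).real {ω | s < f ω} *
            (bondPercolation (zdGraph 3) (criticalProbI 3)).real {ω | t < g ω}) →
    (∃ c : ℝ, 0 < c ∧ ∃ r₀ : ℕ, ∀ r : ℕ, r₀ ≤ r →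
      let K : Finset (Sym2 (Site 3)) :=
        armEdges (r / 8) (0 : Site 3) ∪ armEdges (r / 8) ![(r : ℤ), (r : ℤ), 0] ∪
          armEdges (r / 8) ![(r : ℤ), 0, (r : ℤ)] ∪ armEdges (r / 8) ![0, (r : ℤ), (r : ℤ)];
      let f : BondConfig (Site 3) → ℝ :=
        blockCondProb (zdGraph 3) (criticalProbI 3) K (openConn (0 : Site 3) ![(r : ℤ), (r : ℤ), 0]);
      let g : BondConfig (Site 3) → ℝ :=
        blockCondProb (zdGraph 3) (criticalProbI 3) K (openConn ![(r : ℤ), 0, (r : ℤ)] ![0, (r : ℤ), (r : ℤ)]);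
      c * (∫ ω, f ω ^ 2 ∂(bondPercolation (zdGraph 3) (criticalProbI 3)) -
            (∫ ω, f ω ∂(bondPercolation (zdGraph 3) (criticalProbI 3))) ^ 2) ≤
        ∫ ω, f ω * g ω ∂(bondPercolation (zdGraph 3) (criticalProbI 3)) -
          (∫ ω, f ω ∂(bondPercolation (zdGraph 3) (criticalProbI 3))) *
            (∫ ω, g ω ∂(bondPercolation (zdGraph 3) (criticalProbI 3)))) :=
  Summit.CriticalPhenomena.PercolationContinuityZ3.Theorems.TetrahedronHarrisGap.stub_coherence_of_cornerBallInputs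

/-! ## Composition (rev 5): blocking ∧ coherence ⟹ crux (LANDED p121115) -/

/-- **The line concludes the crux BY NAME** from the registered stubs; no `sorry` of its own (its only
non-standard axiom is the `sorryAx` of the stubs it invokes).  The composition is the LANDED reduction
`crux_of_block_of_coherence` (p121115, `Theorems/PercTreeValueTetrahedronHarrisGapCoherenceReduction.lean`):
`P(A ∩ B) ≥ ∫ f g` (conditional Harris in the corner block) `≥ τ_A τ_B + c · Var f` (coherence; tower property)
`≥ τ_A τ_B + c c_B τ_A²` (`Var f ≥ P(f = 0) τ_A²`, blocking) `= (1 + c c_B) τ_A τ_B` (`τ_B = τ_A`, `tau_opposite_edge_eq`). -/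
theorem TetrahedronHarrisGap_of :
    Summit.CriticalPhenomena.PercolationContinuityZ3.Theses.PercTreeValue.TetrahedronHarrisGap :=
  Summit.CriticalPhenomena.PercolationContinuityZ3.Theorems.TetrahedronHarrisGap.crux_of_block_of_coherence
    stub_block stub_coherence

/-! ## Rev 7 (lead c3, 2026-08-17): the HARVESTED term on the closed collar of the sibling crux's box

Write `P = P_{p_c}`, `a = a_r = (r,r,0)`, `b = b_r = (r,0,r)`, `c = c_r = (0,r,r)`, `k = ⌊r/8⌋`,
`R_r = [−r,2r]² × [−2r, 3k]` (the box of 7798's registered open stub `stub_boxRestriction`, S5'),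
`R'_r = R_r + B(2k−1)` with roof `5k − 1`, `U_r = {x | r − 3k ≤ x₂}` (∋ `b, c`, disjoint from `R'_r`),
`K_r` = the (finite) set of PAIRS inside the collar `R'_r ∖ R_r`, `W_r = {0 ↔ a in R_r} ∩ {b ↔ c in U_r}`
(determined OFF `K_r`), and `f = P(0 ↔ b | ω off K_r)` (`blockCondProb … K_r (openConn 0 b)`).

1. Total covariance + conditional Harris in the block (all LANDED: `integral_blockCondProb_eq`,
   `measureReal_mul_le_integral_blockCondProb_mul`, `blockCondProb_mul_blockCondProb_le`):
   `P(A'∩B') − P(A')P(B') ≥ ∫ [P(A'∩B'|η) − P(A'|η)P(B'|η)] dP ≥ ∫_S [same]` for every measurable `S`, where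
   `A' = {0↔b}`, `B' = {a↔c}` is the CROSSED pair.
2. ON `W_r` THE THREE CONDITIONAL PROBABILITIES COINCIDE (`stub_offCollarIdentity`, pure transitivity: the glued configuration
   keeps `0↔a` and `b↔c`, so `0↔b ⟺ a↔c ⟺ both`): the integrand is `f − f² = f(1−f)` there — the harvested covariance is
   EVALUATED, not estimated.
3. On `S = W_r ∩ {f ≥ κ}`: `f(1−f) ≥ κ(1−f)`, and `∫_S (1−f) = P(S ∩ {0↮b})` (`stub_setIntegral_blockCondProb`, `S` is off-`K_r`)
   `≥ P(S ∩ Shell(R_r,R'_r)) = P(S)·P(Shell)` (a closed collar separates `0 ∈ R_r` from `b ∉ R'_r`: LANDED `shellDecoupling_subset`;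
   the shell event lives ON `K_r`: exact independence `bondPercolation_real_inter_of_disjoint`) `≥ P(S)·c_X^(51³)`
   (`stub_collarShellProbability` = the tiling of 7798's TransferD, from X_B).
4. `P(S) ≥ (c_g − κ)·P(W_r)` from RESTRICTED GLUING `P(W_r ∩ {0↔b}) ≥ c_g P(W_r)` (`stub_restrictedGluing`, NEW) since
   `P(W_r ∩ {0↔b}) = ∫_{W_r} f ≤ κ P(W_r) + P(W_r ∩ {f≥κ})`; take `κ = c_g/2`.
5. `P(W_r) = P(0↔a in R_r)·P(b↔c in U_r) ≥ (c τ(0,a))²` (LANDED `stub_restrictProduct`, `stub_mirrorRestrict`; `stub_boxRestriction`).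
6. `τ(0,b) = τ(a,c) = τ(0,a) = τ(b,c)` and `P(0↔a ∧ b↔c) = P(0↔b ∧ a↔c)` (lattice symmetries, `stub_crossedPairSymmetry`).
Hence `P(0↔a ∧ b↔c) ≥ (1 + (c_g²/4)·c_X^(51³)·c²)·τ(0,a)τ(b,c)`: **crux ⇐ X_B ∧ BoxRestriction ∧ RestrictedGluing**.
World bookkeeping: X_B fails in every jump world and above six dimensions (it carries the continuity content, shared with 7798 and
route PercAnnulusCrossing); BoxRestriction and RestrictedGluing HOLD in a jump world (the giant fills boxes and glues) — world-neutral.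
-/

/-! ### Registered stubs of rev 7 -/

/-- **stub_boxRestriction** (OPEN, world-neutral; = the registered open stub S5' `stub_boxRestriction` of the sibling crux
stmt-CriticalPhenomena-7798, line `Sketch`, VERBATIM — one statement serves both cruxes): at `p_c`, `0 ↔ a_r` INSIDE the box
`[−r,2r]² × [−2r, 3⌊r/8⌋]` at rate `≥ c τ(0,a_r)` (van den Berg–Don-type restriction cost, mildest box form). -/
theorem stub_boxRestriction :
    ∃ c : ℝ, 0 < c ∧ ∃ r₀ : ℕ, ∀ r : ℕ, r₀ ≤ r →
      c * tau 3 (criticalProbI 3) 0 ![(r : ℤ), (r : ℤ), 0] ≤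
        (bondPercolation (zdGraph 3) (criticalProbI 3)).real
          (openConnIn
            {x : Site 3 | -(r : ℤ) ≤ x 0 ∧ x 0 ≤ 2 * (r : ℤ) ∧ -(r : ℤ) ≤ x 1 ∧ x 1 ≤ 2 * (r : ℤ) ∧
              -(2 * (r : ℤ)) ≤ x 2 ∧ x 2 ≤ 3 * ((r : ℤ) / 8)}
            (0 : Site 3) ![(r : ℤ), (r : ℤ), 0]) := by
  sorry

/-- **stub_restrictedGluing** (OPEN, NEW — the single new input of rev 7; world-neutral): RESTRICTED GLUING.  Given the two
INDEPENDENT restricted connections `0 ↔ a_r` inside `R_r = [−r,2r]² × [−2r,3⌊r/8⌋]` and `b_r ↔ c_r` inside `U_r = {x₂ ≥ r − 3⌊r/8⌋}`,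
the two clusters are joined (`0 ↔ b_r`) with conditional probability `≥ c`, uniformly in `r`:
`c · P(W_r) ≤ P(W_r ∩ {0 ↔ b_r})`.  TRUE in a jump world (both restricted clusters contain pieces of the giant, which glue across
the gap `3k < x₂ < r − 3k` of width `≍ r/4` w.h.p.); in the continuous world it is a two-fat-sets gluing lower bound at one scale. -/
theorem stub_restrictedGluing :
    ∃ c : ℝ, 0 < c ∧ ∃ r₀ : ℕ, ∀ r : ℕ, r₀ ≤ r →
      c * (bondPercolation (zdGraph 3) (criticalProbI 3)).real
          (openConnIn
              {x : Site 3 | -(r : ℤ) ≤ x 0 ∧ x 0 ≤ 2 * (r : ℤ) ∧ -(r : ℤ) ≤ x 1 ∧ x 1 ≤ 2 * (r : ℤ) ∧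
                -(2 * (r : ℤ)) ≤ x 2 ∧ x 2 ≤ 3 * ((r : ℤ) / 8)}
              (0 : Site 3) ![(r : ℤ), (r : ℤ), 0] ∩
            openConnIn {x : Site 3 | (r : ℤ) - 3 * ((r : ℤ) / 8) ≤ x 2}
              (![(r : ℤ), 0, (r : ℤ)] : Site 3) ![0, (r : ℤ), (r : ℤ)]) ≤
        (bondPercolation (zdGraph 3) (criticalProbI 3)).real
          (openConnIn
              {x : Site 3 | -(r : ℤ) ≤ x 0 ∧ x 0 ≤ 2 * (r : ℤ) ∧ -(r : ℤ) ≤ x 1 ∧ x 1 ≤ 2 * (r : ℤ) ∧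
                -(2 * (r : ℤ)) ≤ x 2 ∧ x 2 ≤ 3 * ((r : ℤ) / 8)}
              (0 : Site 3) ![(r : ℤ), (r : ℤ), 0] ∩
            openConnIn {x : Site 3 | (r : ℤ) - 3 * ((r : ℤ) / 8) ≤ x 2}
              (![(r : ℤ), 0, (r : ℤ)] : Site 3) ![0, (r : ℤ), (r : ℤ)] ∩
            openConn (0 : Site 3) ![(r : ℤ), 0, (r : ℤ)]) := by
  sorry

/-- **stub_restrictedGluing_of_theta_pos — LANDED** (p153247, `Theorems/PercTreeValueTetrahedronHarrisGapRestrictedGluingWorld.lean`; the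
WORLD CERTIFICATE of the new input): if `θ(p_c(ℤ³)) > 0` then `stub_restrictedGluing` holds with `c = θ(p_c)²` (Harris–FKG for the increasing
events `W_r`, `{0↔b_r}` and `τ ≥ θ²`).  Hence `¬ stub_restrictedGluing ⇒ θ(p_c) = 0` (`percolationContinuityZ3_of_not_restrictedGluing`, same
file): the gluing input is world-neutral — it cannot be refuted without settling the conjunct. -/
theorem stub_restrictedGluing_of_theta_pos
    (hθ : 0 < theta (zdGraph 3) (0 : Site 3) (criticalProbI 3)) :
    ∃ c : ℝ, 0 < c ∧ ∃ r₀ : ℕ, ∀ r : ℕ, r₀ ≤ r →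
      c * (bondPercolation (zdGraph 3) (criticalProbI 3)).real
          (openConnIn
              {x : Site 3 | -(r : ℤ) ≤ x 0 ∧ x 0 ≤ 2 * (r : ℤ) ∧ -(r : ℤ) ≤ x 1 ∧ x 1 ≤ 2 * (r : ℤ) ∧
                -(2 * (r : ℤ)) ≤ x 2 ∧ x 2 ≤ 3 * ((r : ℤ) / 8)}
              (0 : Site 3) ![(r : ℤ), (r : ℤ), 0] ∩
            openConnIn {x : Site 3 | (r : ℤ) - 3 * ((r : ℤ) / 8) ≤ x 2}
              (![(r : ℤ), 0, (r : ℤ)] : Site 3) ![0, (r : ℤ), (r : ℤ)]) ≤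
        (bondPercolation (zdGraph 3) (criticalProbI 3)).real
          (openConnIn
              {x : Site 3 | -(r : ℤ) ≤ x 0 ∧ x 0 ≤ 2 * (r : ℤ) ∧ -(r : ℤ) ≤ x 1 ∧ x 1 ≤ 2 * (r : ℤ) ∧
                -(2 * (r : ℤ)) ≤ x 2 ∧ x 2 ≤ 3 * ((r : ℤ) / 8)}
              (0 : Site 3) ![(r : ℤ), (r : ℤ), 0] ∩
            openConnIn {x : Site 3 | (r : ℤ) - 3 * ((r : ℤ) / 8) ≤ x 2}
              (![(r : ℤ), 0, (r : ℤ)] : Site 3) ![0, (r : ℤ), (r : ℤ)] ∩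
            openConn (0 : Site 3) ![(r : ℤ), 0, (r : ℤ)]) :=
  Summit.CriticalPhenomena.PercolationContinuityZ3.Theorems.TetrahedronHarrisGap.stub_restrictedGluing_of_theta_pos hθ

/-- **stub_offCollarIdentity — LANDED** (p148114, `Theorems/PercTreeValueTetrahedronHarrisGapStubOffCollarIdentity.lean`) (PROVABLE, general): if the finite block `K` contains no pair inside `R` and no pair inside `U`,
then on `{x ↔ a in R} ∩ {b ↔ c in U}` the block-conditional probabilities of `{a ↔ c}`, `{x ↔ b}` and `{x ↔ b} ∩ {a ↔ c}`
COINCIDE: every glued configuration `ω ∖ K ∪ ξ` keeps the two restricted connections (`determinedBy_openConnIn`), and then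
`x ↔ b ⟺ a ↔ c ⟺ both` by transitivity of `↔` (`blockCondProb_eq_real`). -/
theorem stub_offCollarIdentity :
    ∀ {V : Type*} [Countable V] (G : SimpleGraph V) (p : unitInterval) (K : Finset (Sym2 V)) (R U : Set V)
      (x a b c : V), Disjoint (↑K : Set (Sym2 V)) R.sym2 → Disjoint (↑K : Set (Sym2 V)) U.sym2 →
      ∀ ω ∈ openConnIn R x a ∩ openConnIn U b c,
        blockCondProb G p K (openConn a c) ω = blockCondProb G p K (openConn x b) ω ∧
        blockCondProb G p K (openConn x b ∩ openConn a c) ω = blockCondProb G p K (openConn x b) ω :=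
  Summit.CriticalPhenomena.PercolationContinuityZ3.Theorems.TetrahedronHarrisGap.stub_offCollarIdentity

/-- **stub_determinedBy_blockCondProb — LANDED** (p149690, `Theorems/PercTreeValueTetrahedronHarrisGapStubDeterminedByBlockCondProb.lean`) (PROVABLE, general): `P_p(E | ω off K)` is a function of `ω ∖ K`
(`blockCondProb_sdiff_union` in congruence form), hence every super-level set `{κ ≤ P_p(E | ω off K)}` is determined by the
coordinates OFF the block. -/
theorem stub_determinedBy_blockCondProb :
    ∀ {V : Type*} [Countable V] (G : SimpleGraph V) (p : unitInterval) (K : Finset (Sym2 V)) (E : Set (BondConfig V)),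
      (∀ ω ω' : BondConfig V, ω \ (↑K : Set (Sym2 V)) = ω' \ ↑K → blockCondProb G p K E ω = blockCondProb G p K E ω') ∧
      ∀ κ : ℝ, DeterminedBy {ω : BondConfig V | κ ≤ blockCondProb G p K E ω} (↑K : Set (Sym2 V))ᶜ :=
  Summit.CriticalPhenomena.PercolationContinuityZ3.Theorems.TetrahedronHarrisGap.stub_determinedBy_blockCondProb

/-- **stub_setIntegral_blockCondProb — LANDED** (p150601, `Theorems/PercTreeValueTetrahedronHarrisGapStubSetIntegralBlockCondProb.lean`) (PROVABLE, general; the tower property on an off-block event): for a measurable event `S`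
determined by the coordinates off the finite block `K` and a measurable `E`,
`∫ 1_S · P_p(E | ω off K) dP_p = P_p(E ∩ S)` (pointwise `1_S · P_p(E | · off K) = P_p(E ∩ S | · off K)`, then
`integral_blockCondProb_eq`). -/
theorem stub_setIntegral_blockCondProb :
    ∀ {V : Type*} [Countable V] (G : SimpleGraph V) (p : unitInterval) (K : Finset (Sym2 V)) {E S : Set (BondConfig V)},
      MeasurableSet E → MeasurableSet S → DeterminedBy S (↑K : Set (Sym2 V))ᶜ →
      ∫ ω, S.indicator (fun _ => (1 : ℝ)) ω * blockCondProb G p K E ω ∂(bondPercolation G p) =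
        (bondPercolation G p).real (E ∩ S) :=
  Summit.CriticalPhenomena.PercolationContinuityZ3.Theorems.TetrahedronHarrisGap.stub_setIntegral_blockCondProb

/-- **stub_collarShellProbability — LANDED** (p151166, `Theorems/PercTreeValueTetrahedronHarrisGapStubCollarShellProbability.lean`)  (PROVABLE = the tiling step of 7798's `stub_cruxOfTiledShell`, TransferD, for the SAME
`R_r ⊆ R'_r`): from X_B, for `r ≥ 64` the closed-collar event `Shell(R_r, R'_r)` — no open path of `R'_r ∖ R_r` from a vertex
adjacent to `R_r` to a vertex adjacent to `R'_rᶜ` — has probability `≥ c_X^(51³)` (`stub_tiledShell` on the grid of `≤ 51³`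
translated aspect-2 annuli of size `s = ⌊r/16⌋ − 1`). -/
theorem stub_collarShellProbability
    (hXB : ∃ c : ℝ, 0 < c ∧ ∀ n : ℕ, 1 ≤ n →
      (bondPercolation (zdGraph 3) (criticalProbI 3)).real
          {ω | ∃ x ∈ box 3 n, ∃ y ∈ innerBoundary (zdGraph 3) (box 3 (2 * n)),
            ω ∈ openConnIn ↑(box 3 (2 * n)) x y} ≤ 1 - c) :
    ∃ cS : ℝ, 0 < cS ∧ ∀ r : ℕ, 64 ≤ r →
      cS ≤ (bondPercolation (zdGraph 3) (criticalProbI 3)).real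
        {ω | ∀ u ∈ {x : Site 3 | -(r : ℤ) - (2 * ((r : ℤ) / 8) - 1) ≤ x 0 ∧ x 0 ≤ 2 * (r : ℤ) + (2 * ((r : ℤ) / 8) - 1) ∧
                -(r : ℤ) - (2 * ((r : ℤ) / 8) - 1) ≤ x 1 ∧ x 1 ≤ 2 * (r : ℤ) + (2 * ((r : ℤ) / 8) - 1) ∧
                -(2 * (r : ℤ)) - (2 * ((r : ℤ) / 8) - 1) ≤ x 2 ∧ x 2 ≤ 5 * ((r : ℤ) / 8) - 1} \
              {x : Site 3 | -(r : ℤ) ≤ x 0 ∧ x 0 ≤ 2 * (r : ℤ) ∧ -(r : ℤ) ≤ x 1 ∧ x 1 ≤ 2 * (r : ℤ) ∧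
                -(2 * (r : ℤ)) ≤ x 2 ∧ x 2 ≤ 3 * ((r : ℤ) / 8)},
          ∀ w ∈ {x : Site 3 | -(r : ℤ) - (2 * ((r : ℤ) / 8) - 1) ≤ x 0 ∧ x 0 ≤ 2 * (r : ℤ) + (2 * ((r : ℤ) / 8) - 1) ∧
                -(r : ℤ) - (2 * ((r : ℤ) / 8) - 1) ≤ x 1 ∧ x 1 ≤ 2 * (r : ℤ) + (2 * ((r : ℤ) / 8) - 1) ∧
                -(2 * (r : ℤ)) - (2 * ((r : ℤ) / 8) - 1) ≤ x 2 ∧ x 2 ≤ 5 * ((r : ℤ) / 8) - 1} \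
              {x : Site 3 | -(r : ℤ) ≤ x 0 ∧ x 0 ≤ 2 * (r : ℤ) ∧ -(r : ℤ) ≤ x 1 ∧ x 1 ≤ 2 * (r : ℤ) ∧
                -(2 * (r : ℤ)) ≤ x 2 ∧ x 2 ≤ 3 * ((r : ℤ) / 8)},
          (∃ z ∈ {x : Site 3 | -(r : ℤ) ≤ x 0 ∧ x 0 ≤ 2 * (r : ℤ) ∧ -(r : ℤ) ≤ x 1 ∧ x 1 ≤ 2 * (r : ℤ) ∧
                -(2 * (r : ℤ)) ≤ x 2 ∧ x 2 ≤ 3 * ((r : ℤ) / 8)}, (zdGraph 3).Adj u z) →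
          (∃ z ∉ {x : Site 3 | -(r : ℤ) - (2 * ((r : ℤ) / 8) - 1) ≤ x 0 ∧ x 0 ≤ 2 * (r : ℤ) + (2 * ((r : ℤ) / 8) - 1) ∧
                -(r : ℤ) - (2 * ((r : ℤ) / 8) - 1) ≤ x 1 ∧ x 1 ≤ 2 * (r : ℤ) + (2 * ((r : ℤ) / 8) - 1) ∧
                -(2 * (r : ℤ)) - (2 * ((r : ℤ) / 8) - 1) ≤ x 2 ∧ x 2 ≤ 5 * ((r : ℤ) / 8) - 1}, (zdGraph 3).Adj w z) →
          ω ∉ openConnIn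
            ({x : Site 3 | -(r : ℤ) - (2 * ((r : ℤ) / 8) - 1) ≤ x 0 ∧ x 0 ≤ 2 * (r : ℤ) + (2 * ((r : ℤ) / 8) - 1) ∧
                -(r : ℤ) - (2 * ((r : ℤ) / 8) - 1) ≤ x 1 ∧ x 1 ≤ 2 * (r : ℤ) + (2 * ((r : ℤ) / 8) - 1) ∧
                -(2 * (r : ℤ)) - (2 * ((r : ℤ) / 8) - 1) ≤ x 2 ∧ x 2 ≤ 5 * ((r : ℤ) / 8) - 1} \
              {x : Site 3 | -(r : ℤ) ≤ x 0 ∧ x 0 ≤ 2 * (r : ℤ) ∧ -(r : ℤ) ≤ x 1 ∧ x 1 ≤ 2 * (r : ℤ) ∧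
                -(2 * (r : ℤ)) ≤ x 2 ∧ x 2 ≤ 3 * ((r : ℤ) / 8)}) u w} :=
  Summit.CriticalPhenomena.PercolationContinuityZ3.Theorems.TetrahedronHarrisGap.stub_collarShellProbability hXB

/-- **stub_crossedPairSymmetry — LANDED** (p151031, `Theorems/PercTreeValueTetrahedronHarrisGapStubCrossedPairSymmetry.lean`) (PROVABLE, lattice symmetries of the regular tetrahedron `T_r`): the coordinate swap
`(x₀,x₁,x₂) ↦ (x₀,x₂,x₁)` fixes `0` and `c_r` and exchanges `a_r ↔ b_r`, so `P(0↔a_r ∧ b_r↔c_r) = P(0↔b_r ∧ a_r↔c_r)` and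
`τ(0,b_r) = τ(0,a_r)`; the isometry `x ↦ (r − x₀, x₁, −x₂) ` … (any automorphism with `0 ↦ a_r`, `a_r`-image `c_r`) gives
`τ(a_r,c_r) = τ(0,a_r)` (`bondPercolation_real_preimage_relabel_iso`, `pairSymm_preimage_relabel_openConn`). -/
theorem stub_crossedPairSymmetry :
    ∀ (p : unitInterval) (r : ℕ),
      (bondPercolation (zdGraph 3) p).real
          (openConn (0 : Site 3) ![(r : ℤ), (r : ℤ), 0] ∩ openConn (![(r : ℤ), 0, (r : ℤ)] : Site 3) ![0, (r : ℤ), (r : ℤ)]) =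
        (bondPercolation (zdGraph 3) p).real
          (openConn (0 : Site 3) ![(r : ℤ), 0, (r : ℤ)] ∩ openConn (![(r : ℤ), (r : ℤ), 0] : Site 3) ![0, (r : ℤ), (r : ℤ)]) ∧
      tau 3 p 0 ![(r : ℤ), 0, (r : ℤ)] = tau 3 p 0 ![(r : ℤ), (r : ℤ), 0] ∧
      tau 3 p ![(r : ℤ), (r : ℤ), 0] ![0, (r : ℤ), (r : ℤ)] = tau 3 p 0 ![(r : ℤ), (r : ℤ), 0] :=
  Summit.CriticalPhenomena.PercolationContinuityZ3.Theorems.TetrahedronHarrisGap.stub_crossedPairSymmetry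

/-! ### Composition (rev 7): X_B ∧ BoxRestriction ∧ RestrictedGluing ⟹ crux -/

/-- **stub_cruxOfCollar — LANDED** (p152050, `Theorems/PercTreeValueTetrahedronHarrisGapCollarReduction.lean`)  (the rev-7 composition as a transfer statement; lead c3): X_B (stmt-0846, verbatim),
BOX RESTRICTION (7798's S5', verbatim) and RESTRICTED GLUING imply the crux formula, unfolded, with
`δ = (c_g² / 4) · c_S · c²` (`c_S = c_X^(51³)`), `r₀ = max (max r₁ r₂) 64`.  Proof = items 1–6 of the rev-7 docstring. -/
theorem stub_cruxOfCollar
    (hXB : ∃ c : ℝ, 0 < c ∧ ∀ n : ℕ, 1 ≤ n →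
      (bondPercolation (zdGraph 3) (criticalProbI 3)).real
          {ω | ∃ x ∈ box 3 n, ∃ y ∈ innerBoundary (zdGraph 3) (box 3 (2 * n)),
            ω ∈ openConnIn ↑(box 3 (2 * n)) x y} ≤ 1 - c)
    (hBox : ∃ c : ℝ, 0 < c ∧ ∃ r₀ : ℕ, ∀ r : ℕ, r₀ ≤ r →
      c * tau 3 (criticalProbI 3) 0 ![(r : ℤ), (r : ℤ), 0] ≤
        (bondPercolation (zdGraph 3) (criticalProbI 3)).real
          (openConnIn
            {x : Site 3 | -(r : ℤ) ≤ x 0 ∧ x 0 ≤ 2 * (r : ℤ) ∧ -(r : ℤ) ≤ x 1 ∧ x 1 ≤ 2 * (r : ℤ) ∧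
              -(2 * (r : ℤ)) ≤ x 2 ∧ x 2 ≤ 3 * ((r : ℤ) / 8)}
            (0 : Site 3) ![(r : ℤ), (r : ℤ), 0]))
    (hGlue : ∃ c : ℝ, 0 < c ∧ ∃ r₀ : ℕ, ∀ r : ℕ, r₀ ≤ r →
      c * (bondPercolation (zdGraph 3) (criticalProbI 3)).real
          (openConnIn
              {x : Site 3 | -(r : ℤ) ≤ x 0 ∧ x 0 ≤ 2 * (r : ℤ) ∧ -(r : ℤ) ≤ x 1 ∧ x 1 ≤ 2 * (r : ℤ) ∧
                -(2 * (r : ℤ)) ≤ x 2 ∧ x 2 ≤ 3 * ((r : ℤ) / 8)}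
              (0 : Site 3) ![(r : ℤ), (r : ℤ), 0] ∩
            openConnIn {x : Site 3 | (r : ℤ) - 3 * ((r : ℤ) / 8) ≤ x 2}
              (![(r : ℤ), 0, (r : ℤ)] : Site 3) ![0, (r : ℤ), (r : ℤ)]) ≤
        (bondPercolation (zdGraph 3) (criticalProbI 3)).real
          (openConnIn
              {x : Site 3 | -(r : ℤ) ≤ x 0 ∧ x 0 ≤ 2 * (r : ℤ) ∧ -(r : ℤ) ≤ x 1 ∧ x 1 ≤ 2 * (r : ℤ) ∧
                -(2 * (r : ℤ)) ≤ x 2 ∧ x 2 ≤ 3 * ((r : ℤ) / 8)}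
              (0 : Site 3) ![(r : ℤ), (r : ℤ), 0] ∩
            openConnIn {x : Site 3 | (r : ℤ) - 3 * ((r : ℤ) / 8) ≤ x 2}
              (![(r : ℤ), 0, (r : ℤ)] : Site 3) ![0, (r : ℤ), (r : ℤ)] ∩
            openConn (0 : Site 3) ![(r : ℤ), 0, (r : ℤ)])) :
    ∃ δ : ℝ, 0 < δ ∧ ∃ r₀ : ℕ, ∀ r : ℕ, r₀ ≤ r →
      (1 + δ) * tau 3 (criticalProbI 3) 0 ![(r : ℤ), (r : ℤ), 0] *
          tau 3 (criticalProbI 3) ![(r : ℤ), 0, (r : ℤ)] ![0, (r : ℤ), (r : ℤ)] ≤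
        (bondPercolation (zdGraph 3) (criticalProbI 3)).real
          (openConn 0 ![(r : ℤ), (r : ℤ), 0] ∩ openConn ![(r : ℤ), 0, (r : ℤ)] ![0, (r : ℤ), (r : ℤ)]) :=
  Summit.CriticalPhenomena.PercolationContinuityZ3.Theorems.TetrahedronHarrisGap.stub_cruxOfCollar hXB hBox hGlue

/-- **stub_cruxOfCollarByName** (the rev-7 composition concluded BY NAME, registered so that its landed file rides
`--supports`): `CritAnnulusNonCrossing` (stmt-0846, by name) ∧ BoxRestriction (7798's S5') ∧ RestrictedGluing ⟹ `TetrahedronHarrisGap`. -/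
theorem stub_cruxOfCollarByName
    (hXB : Summit.CriticalPhenomena.PercolationContinuityZ3.Theses.PercAnnulusCrossing.CritAnnulusNonCrossing)
    (hBox : ∃ c : ℝ, 0 < c ∧ ∃ r₀ : ℕ, ∀ r : ℕ, r₀ ≤ r →
      c * tau 3 (criticalProbI 3) 0 ![(r : ℤ), (r : ℤ), 0] ≤
        (bondPercolation (zdGraph 3) (criticalProbI 3)).real
          (openConnIn
            {x : Site 3 | -(r : ℤ) ≤ x 0 ∧ x 0 ≤ 2 * (r : ℤ) ∧ -(r : ℤ) ≤ x 1 ∧ x 1 ≤ 2 * (r : ℤ) ∧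
              -(2 * (r : ℤ)) ≤ x 2 ∧ x 2 ≤ 3 * ((r : ℤ) / 8)}
            (0 : Site 3) ![(r : ℤ), (r : ℤ), 0]))
    (hGlue : ∃ c : ℝ, 0 < c ∧ ∃ r₀ : ℕ, ∀ r : ℕ, r₀ ≤ r →
      c * (bondPercolation (zdGraph 3) (criticalProbI 3)).real
          (openConnIn
              {x : Site 3 | -(r : ℤ) ≤ x 0 ∧ x 0 ≤ 2 * (r : ℤ) ∧ -(r : ℤ) ≤ x 1 ∧ x 1 ≤ 2 * (r : ℤ) ∧
                -(2 * (r : ℤ)) ≤ x 2 ∧ x 2 ≤ 3 * ((r : ℤ) / 8)}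
              (0 : Site 3) ![(r : ℤ), (r : ℤ), 0] ∩
            openConnIn {x : Site 3 | (r : ℤ) - 3 * ((r : ℤ) / 8) ≤ x 2}
              (![(r : ℤ), 0, (r : ℤ)] : Site 3) ![0, (r : ℤ), (r : ℤ)]) ≤
        (bondPercolation (zdGraph 3) (criticalProbI 3)).real
          (openConnIn
              {x : Site 3 | -(r : ℤ) ≤ x 0 ∧ x 0 ≤ 2 * (r : ℤ) ∧ -(r : ℤ) ≤ x 1 ∧ x 1 ≤ 2 * (r : ℤ) ∧
                -(2 * (r : ℤ)) ≤ x 2 ∧ x 2 ≤ 3 * ((r : ℤ) / 8)}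
              (0 : Site 3) ![(r : ℤ), (r : ℤ), 0] ∩
            openConnIn {x : Site 3 | (r : ℤ) - 3 * ((r : ℤ) / 8) ≤ x 2}
              (![(r : ℤ), 0, (r : ℤ)] : Site 3) ![0, (r : ℤ), (r : ℤ)] ∩
            openConn (0 : Site 3) ![(r : ℤ), 0, (r : ℤ)])) :
    Summit.CriticalPhenomena.PercolationContinuityZ3.Theses.PercTreeValue.TetrahedronHarrisGap := by
  unfold Summit.CriticalPhenomena.PercolationContinuityZ3.Theses.PercAnnulusCrossing.CritAnnulusNonCrossing at hXB
  unfold Summit.CriticalPhenomena.PercolationContinuityZ3.Theses.PercTreeValue.TetrahedronHarrisGap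
  exact stub_cruxOfCollar hXB hBox hGlue

/-- **The line (rev 7) concludes the crux BY NAME** from X_B (`stub_annulusNonCrossing` = stmt-0846), BoxRestriction
(`stub_boxRestriction` = 7798's S5') and RestrictedGluing (`stub_restrictedGluing`), through the composition `stub_cruxOfCollar`. -/
theorem TetrahedronHarrisGap_of_collar :
    Summit.CriticalPhenomena.PercolationContinuityZ3.Theses.PercTreeValue.TetrahedronHarrisGap :=
  stub_cruxOfCollarByName stub_annulusNonCrossing stub_boxRestriction stub_restrictedGluing


end Summit.CriticalPhenomena.PercolationContinuityZ3.Cruxes.TetrahedronHarrisGap.CornerBallTotalCovariance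

end
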